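import Summits.BirchSwinnertonDyer.BirchSwinnertonDyer.Cruxes.PhantomShadow.Disproof
import Summits.BirchSwinnertonDyer.BirchSwinnertonDyer.Theorems.ShadowIsolationShaUnboundedOfCorank
import Summits.BirchSwinnertonDyer.BirchSwinnertonDyer.Theorems.ShadowIsolationSelmerRankUBStubShaCotorsionBigImage
import Literature.Barriers.BirchSwinnertonDyer.RankNotSumOfLocalInvariantsF4TwistPoints2993

/-!
# Crux `PhantomShadow` (stmt-BirchSwinnertonDyer-15787) — redirect strategist r1 (second opinion):
# the theorems that place the crux, kernel-checked

Work file of `planner-cstrat-stmt-BirchSwinnertonDyer-15787-r1-0` (crux-strategist, REDIRECT r1, 2026-08-17),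
companion of `STRATEGY-CENSUS.md` (r1). Everything here is sorry-free and imports only landed tree files
(the standing disprover's `Disproof.lean` for the conclusion predicate `ShadowAt`, the landed support item
`shaUnboundedOfCorank_proof`, the landed discharge `shaCotorsion_irreducible_of_isolation_of_shadow`, and the
tree's PROVED rank-two curve `480a1^(−2993)` of Dokchitser–Dokchitser 2011).

Notation: `ShadowAt W p n` = the crux's conclusion at `(W,p,n)` (Disproof §1); `Isolation` =
`IsolationOfAccidentalZeros` (the route's other crux, stmt-BirchSwinnertonDyer-15786).

## What is proved

§1 SECTORS. `PhantomShadow ↔ PhantomShadowDiv ∧ PhantomShadowFin` (`phantomShadow_iff_div_and_fin`), where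
`PhantomShadowDiv` (σ-free: positive `ℤ_p`-corank of `Ш[p^∞]` ⇒ shadows at every depth) is the only sector the
route's deciding theorem consumes and `PhantomShadowFin` (finite `Ш[p^∞]` with an element of exact order `pⁿ` ⇒
a shadow at depth `n`) is consumed by nothing.

§2 PLACEMENT RELATIVE TO THE ROUTE. `ShaCotorsionIrreducible → PhantomShadowDiv` outright (ex falso:
`phantomShadowDiv_of_shaCotorsion`) and `Isolation → PhantomShadowDiv → ShaCotorsionIrreducible`
(`shaCotorsion_of_isolation_of_div`); hence **given the sibling crux, the used sector of `PhantomShadow` is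
EQUIVALENT to Ш[p^∞]-cotorsion on the irreducible good-ordinary sector** (`phantomShadowDiv_iff_of_isolation`),
and the full crux is that conjunction with the unused finite sector (`phantomShadow_iff_of_isolation`).
Ш-cotorsion is the open core named by `Literature.Barriers.BirchSwinnertonDyer.SelmerRankBarrierNarrow` and is
route SelmerRank's bare crux `SelmerRankShaPFinite` (stmt-BirchSwinnertonDyer-0132) restricted to this sector
(`shaCotorsionIrreducible_of_shaPFinite`).

§3 NO SELMER-DRIVEN MECHANISM. The "finite-depth symmetry" objection of the ideation round (points of `E` and
divisible Ш-classes are indistinguishable in `Sel_{pⁿ}(E)`) made into theorems: any principle producing the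
shadow from the MORDELL–WEIL rank (`RankShadow`: rank `≥ 2` ⇒ shadows at every depth) or from the SELMER corank
(`SelmerShadow k`: `corank Sel_{p^∞} ≥ k` ⇒ shadows at every depth, `k ≤ 2`) is REFUTED by `Isolation`
(`not_rankShadow_of_isolation`, `not_selmerShadow_of_isolation`) — witnessed in-tree by the rank-two curve
`480a1^(−2993)` (`two_le_mordellWeilRank_neg2993`), a global minimal model of it, and the route's proved prime
supply. Since `PhantomShadowDiv`'s hypothesis enters every transported-Selmer / Kato-repulsion / reciprocity-law
argument only through `corank Sel_{p^∞}(E) = r + c ≥ 1` (`≥ 2` in even sign), such an argument proves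
`SelmerShadow 1` or `SelmerShadow 2` verbatim and therefore kills the route's other crux: a proof of the used
sector compatible with the route must separate `T_pШ` from `E(ℚ) ⊗ ℤ_p`, for which no invariant is known.
(`selmerShadow_one_imp_div`: `SelmerShadow 1 → PhantomShadowDiv` records that the weakest Selmer-driven
principle does imply the used sector — and is refuted.)
-/

set_option linter.dupNamespace false

namespace Summit.BirchSwinnertonDyer.BirchSwinnertonDyer.Cruxes.PhantomShadow.StrategistR1

open Summit.BirchSwinnertonDyer.BirchSwinnertonDyer.Theses.ShadowIsolation
open Summit.BirchSwinnertonDyer.BirchSwinnertonDyer.Cruxes.PhantomShadow.Disproof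
open Literature.NumberTheory.EllipticCurves.ModularForms

/-! ## §0 The typed sectors and principles -/

/-- Ш[p^∞]-cotorsion on the crux's sector: for `W/ℚ` globally minimal elliptic and `p ≥ 5` good ordinary with
`E[p]` irreducible, `corank_{ℤ_p} Ш(E/ℚ)[p^∞] = 0`. -/
def ShaCotorsionIrreducible : Prop :=
  ∀ (W : WeierstrassCurve ℚ) [W.IsElliptic] [W.IsGloballyMinimal] (p : ℕ) [Fact p.Prime],
    5 ≤ p → W.HasGoodReductionAtPrime p → ¬ (p : ℤ) ∣ W.frobeniusTrace p →
    W.HasIrreducibleModPGaloisRep p → W.shaCorank p = 0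

/-- The DIVISIBLE sector of `PhantomShadow` (σ-free; strategist b1's `PhantomShadowDiv`): a positive
`ℤ_p`-corank of `Ш[p^∞]` forces a shadow at every depth `n ≥ 1`. This is the only sector `closes` uses. -/
def PhantomShadowDiv : Prop :=
  ∀ (W : WeierstrassCurve ℚ) [W.IsElliptic] [W.IsGloballyMinimal] (p : ℕ) [Fact p.Prime],
    5 ≤ p → W.HasGoodReductionAtPrime p → ¬ (p : ℤ) ∣ W.frobeniusTrace p →
    W.HasIrreducibleModPGaloisRep p → W.shaCorank p ≠ 0 → ∀ n : ℕ, 1 ≤ n → ShadowAt W p n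

/-- The FINITE sector of `PhantomShadow`: `Ш[p^∞]` of corank `0` (i.e. finite) with an element of exact order
`pⁿ` forces a shadow at depth `n`. Consumed by nothing in the route; heuristically false for deep elements. -/
def PhantomShadowFin : Prop :=
  ∀ (W : WeierstrassCurve ℚ) [W.IsElliptic] [W.IsGloballyMinimal] (p : ℕ) [Fact p.Prime],
    5 ≤ p → W.HasGoodReductionAtPrime p → ¬ (p : ℤ) ∣ W.frobeniusTrace p →
    W.HasIrreducibleModPGaloisRep p → W.shaCorank p = 0 → ∀ n : ℕ, 1 ≤ n →
    (∃ σ : W.sha, addOrderOf σ = p ^ n) → ShadowAt W p n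

/-- RANK SHADOW: Mordell–Weil rank `≥ 2` forces a shadow at every depth (what any points/phantom-symmetric
mechanism for the divisible sector would also prove). -/
def RankShadow : Prop :=
  ∀ (W : WeierstrassCurve ℚ) [W.IsElliptic] [W.IsGloballyMinimal] (p : ℕ) [Fact p.Prime],
    5 ≤ p → W.HasGoodReductionAtPrime p → ¬ (p : ℤ) ∣ W.frobeniusTrace p →
    W.HasIrreducibleModPGaloisRep p → 2 ≤ W.mordellWeilRank → ∀ n : ℕ, 1 ≤ n → ShadowAt W p n

/-- SELMER SHADOW at threshold `k`: `corank_{ℤ_p} Sel_{p^∞}(E/ℚ) ≥ k` forces a shadow at every depth (the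
output shape of every transported-Selmer / Kato-repulsion argument, which reads `r + c`, never `c`). -/
def SelmerShadow (k : ℕ) : Prop :=
  ∀ (W : WeierstrassCurve ℚ) [W.IsElliptic] [W.IsGloballyMinimal] (p : ℕ) [Fact p.Prime],
    5 ≤ p → W.HasGoodReductionAtPrime p → ¬ (p : ℤ) ∣ W.frobeniusTrace p →
    W.HasIrreducibleModPGaloisRep p → k ≤ W.selmerCorank p → ∀ n : ℕ, 1 ≤ n → ShadowAt W p n

/-! ## §1 Sectors -/

/-- `PhantomShadow` is exactly the conjunction of its two sectors (the divisible one through the landed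
support item `ShaUnboundedOfCorank`: a positive corank supplies an element of every exact order `pⁿ`). -/
theorem phantomShadow_iff_div_and_fin : PhantomShadow ↔ PhantomShadowDiv ∧ PhantomShadowFin := by
  constructor
  · intro hS
    refine ⟨fun W _ _ p _ h5 hg ho hi hne n hn => ?_, fun W _ _ p _ h5 hg ho hi _ n hn hσ => ?_⟩
    · exact hS W p h5 hg ho hi n hn (Theorems.shaUnboundedOfCorank_proof W p hne n)
    · exact hS W p h5 hg ho hi n hn hσ
  · rintro ⟨hD, hF⟩ W _ _ p _ h5 hg ho hi n hn hσ
    by_cases hc : W.shaCorank p = 0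
    · exact hF W p h5 hg ho hi hc n hn hσ
    · exact hD W p h5 hg ho hi hc n hn

/-! ## §2 Placement relative to the route -/

/-- Ш-cotorsion gives the divisible sector OUTRIGHT (its hypothesis becomes contradictory). -/
theorem phantomShadowDiv_of_shaCotorsion (h : ShaCotorsionIrreducible) : PhantomShadowDiv :=
  fun W _ _ p _ h5 hg ho hi hne _ _ => absurd (h W p h5 hg ho hi) hne

/-- Ш-cotorsion and the finite sector give the whole crux. -/
theorem phantomShadow_of_shaCotorsion_of_fin (h : ShaCotorsionIrreducible) (hF : PhantomShadowFin) :
    PhantomShadow :=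
  phantomShadow_iff_div_and_fin.mpr ⟨phantomShadowDiv_of_shaCotorsion h, hF⟩

/-- With the sibling crux, the divisible sector gives Ш-cotorsion back (σ-free version of the landed
`Theorems.shaCotorsion_irreducible_of_isolation_of_shadow`). -/
theorem shaCotorsion_of_isolation_of_div (hI : IsolationOfAccidentalZeros) (hD : PhantomShadowDiv) :
    ShaCotorsionIrreducible := by
  intro W _ _ p _ h5 hg ho hi
  by_contra hne
  obtain ⟨n₀, hn₀⟩ := hI W p h5 hg ho hi
  exact hn₀ (max n₀ 1) (le_max_left _ _) (hD W p h5 hg ho hi hne (max n₀ 1) (le_max_right _ _))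

/-- **Placement, divisible sector.** Given `IsolationOfAccidentalZeros`, the sector of `PhantomShadow` that the
route uses is EQUIVALENT to Ш[p^∞]-cotorsion on the irreducible good-ordinary sector. -/
theorem phantomShadowDiv_iff_of_isolation (hI : IsolationOfAccidentalZeros) :
    PhantomShadowDiv ↔ ShaCotorsionIrreducible :=
  ⟨shaCotorsion_of_isolation_of_div hI, phantomShadowDiv_of_shaCotorsion⟩

/-- **Placement, full crux.** Given `IsolationOfAccidentalZeros`, `PhantomShadow` is EQUIVALENT to
Ш[p^∞]-cotorsion (irreducible sector) together with its unused finite sector. The forward Ш-half is the landed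
`Theorems.shaCotorsion_irreducible_of_isolation_of_shadow`. -/
theorem phantomShadow_iff_of_isolation (hI : IsolationOfAccidentalZeros) :
    PhantomShadow ↔ ShaCotorsionIrreducible ∧ PhantomShadowFin := by
  constructor
  · intro hS
    exact ⟨fun W _ _ p _ h5 hg ho hi =>
        Theorems.shaCotorsion_irreducible_of_isolation_of_shadow hI hS W p h5 hg ho hi,
      (phantomShadow_iff_div_and_fin.mp hS).2⟩
  · rintro ⟨h, hF⟩
    exact phantomShadow_of_shaCotorsion_of_fin h hF

/-- Route SelmerRank's bare crux `SelmerRankShaPFinite` (stmt-BirchSwinnertonDyer-0132: `Ш(E/ℚ)[p^∞]` finite for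
every elliptic `W/ℚ` and every `p`) gives `ShaCotorsionIrreducible` (finite ⇒ corank `0`,
`Literature.BSD.shaCorank_eq_zero_of_finite`), hence the used sector of `PhantomShadow` with no visibility input. -/
theorem shaCotorsionIrreducible_of_shaPFinite
    (h : Summit.BirchSwinnertonDyer.BirchSwinnertonDyer.Theses.SelmerRank.SelmerRankShaPFinite) :
    ShaCotorsionIrreducible :=
  fun W _ _ p _ _ _ _ _ => Literature.BSD.shaCorank_eq_zero_of_finite W p (h W p)

theorem phantomShadowDiv_of_shaPFinite
    (h : Summit.BirchSwinnertonDyer.BirchSwinnertonDyer.Theses.SelmerRank.SelmerRankShaPFinite) :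
    PhantomShadowDiv :=
  phantomShadowDiv_of_shaCotorsion (shaCotorsionIrreducible_of_shaPFinite h)

/-! ## §3 No rank-driven or Selmer-driven mechanism survives the sibling crux -/

/-- The tree's rank-two curve `E = 480a1^(−2993) : y² = x³ + 2993 x² − 6·2993² x` (Dokchitser–Dokchitser 2011,
`two_le_mordellWeilRank_neg2993`, PROVED by explicit points and complete 2-descent). -/
noncomputable def E₂ : WeierstrassCurve ℚ :=
  Literature.Barriers.BirchSwinnertonDyer.curve480a1.quadraticTwist (-2993)

instance E₂_isElliptic : E₂.IsElliptic :=
  Literature.Barriers.BirchSwinnertonDyer.DokchitserDokchitser2011.isElliptic_twist (by norm_num)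

theorem two_le_rank_E₂ : 2 ≤ E₂.mordellWeilRank :=
  Literature.Barriers.BirchSwinnertonDyer.DokchitserDokchitser2011.two_le_mordellWeilRank_neg2993

/-- **`Isolation` refutes `RankShadow`.** Pass to a global minimal model `C • E₂` (the rank is invariant,
AEC III.3.1(b)), take the route's proved supply of a good ordinary `p ≥ 5` with irreducible `E[p]`
(`primeSupplyIrreducible_proof`), let `n₀` be Isolation's bound and read `RankShadow` at depth `max n₀ 1`. -/
theorem not_rankShadow_of_isolation (hI : IsolationOfAccidentalZeros) : ¬ RankShadow := by
  intro hR
  classical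
  obtain ⟨C, hC⟩ := WeierstrassCurve.hasGlobalMinimalModel_rat_holds E₂
  obtain ⟨p, hp, h5, hgood, hord, hirr⟩ := Theorems.primeSupplyIrreducible_proof (C • E₂)
  obtain ⟨n₀, hn₀⟩ := hI (C • E₂) p h5 hgood hord hirr
  have hrank : 2 ≤ (C • E₂).mordellWeilRank := by
    have h : (C • E₂).mordellWeilRank = E₂.mordellWeilRank :=
      @WeierstrassCurve.VariableChange.finrank_point_variableChange ℚ _ E₂ C (Classical.decEq ℚ)
    rw [h]
    exact two_le_rank_E₂
  exact hn₀ (max n₀ 1) (le_max_left _ _) (hR (C • E₂) p h5 hgood hord hirr hrank (max n₀ 1) (le_max_right _ _))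

/-- `SelmerShadow` is antitone in the threshold. -/
theorem selmerShadow_mono {k k' : ℕ} (hk : k ≤ k') (h : SelmerShadow k) : SelmerShadow k' :=
  fun W _ _ p _ h5 hg ho hi hc n hn => h W p h5 hg ho hi (hk.trans hc) n hn

/-- `SelmerShadow 2 → RankShadow` (Greenberg's PROVED corank identity `corank Sel = rank + corank Ш ≥ rank`). -/
theorem rankShadow_of_selmerShadow_two (h : SelmerShadow 2) : RankShadow := by
  intro W _ _ p _ h5 hg ho hi hr n hn
  have hId : W.selmerCorank p = W.mordellWeilRank + W.shaCorank p :=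
    W.selmerCorank_eq_mordellWeilRank_add_holds p
  exact h W p h5 hg ho hi (by omega) n hn

/-- **`Isolation` refutes every `SelmerShadow k`, `k ≤ 2`** — in particular the two shapes a transported-Selmer
argument for the divisible sector would establish (`k = 1`: `c ≥ 1`; `k = 2`: `c ≥ 1` in even sign by
`p`-parity). -/
theorem not_selmerShadow_of_isolation (hI : IsolationOfAccidentalZeros) {k : ℕ} (hk : k ≤ 2) :
    ¬ SelmerShadow k :=
  fun h => not_rankShadow_of_isolation hI (rankShadow_of_selmerShadow_two (selmerShadow_mono hk h))

/-- The weakest Selmer-driven principle does imply the used sector (`c ≠ 0 ⇒ corank Sel ≥ 1`) — and is refuted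
above: the used sector cannot be reached through `corank Sel_{p^∞}(E)` alone without killing the route. -/
theorem selmerShadow_one_imp_div (h : SelmerShadow 1) : PhantomShadowDiv := by
  intro W _ _ p _ h5 hg ho hi hne n hn
  have hId : W.selmerCorank p = W.mordellWeilRank + W.shaCorank p :=
    W.selmerCorank_eq_mordellWeilRank_add_holds p
  exact h W p h5 hg ho hi (by omega) n hn

/-- Packaging for the tribunal: under the sibling crux, (i) the used sector of `PhantomShadow` is Ш-cotorsion,
(ii) no rank- or Selmer-corank-driven principle can deliver it. -/
theorem placement (hI : IsolationOfAccidentalZeros) :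
    (PhantomShadowDiv ↔ ShaCotorsionIrreducible) ∧ ¬ RankShadow ∧ ¬ SelmerShadow 1 ∧ ¬ SelmerShadow 2 :=
  ⟨phantomShadowDiv_iff_of_isolation hI, not_rankShadow_of_isolation hI,
    not_selmerShadow_of_isolation hI (by norm_num), not_selmerShadow_of_isolation hI le_rfl⟩

end Summit.BirchSwinnertonDyer.BirchSwinnertonDyer.Cruxes.PhantomShadow.StrategistR1
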